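import Summits.ABC.IUTFork.Joshi.ThetaJoshiAdelic
import Summits.ABC.IUTFork.Joshi.LocalPeriodRingsProofs
import HarnessLib

/-!
# Joshi, ATS III §6.7 over the §5 period rings: Theorem 6.7.1 and the adelic lift family REALISED on slot T-09's carriers
# (merge-debt T-09 → T-11, proof/bridge file, companion of `ThetaJoshiLocusBE.lean` / `ThetaJoshiAdelic.lean`)

abc-iut cell, block E («type Joshi's construction, test vs S», rung LADDER-ABC:A2.E), seat abc-iut-E-t11 (gen 2), slot T-11
of `HOME/plan/E/ASSIGNMENTS.md` (§3 merge-debts; §4 fallback (4) «replace interim fields by imports; proof-only bridge file»).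
Source: K. Joshi, *Construction of Arithmetic Teichmüller Spaces III*, arXiv:2401.13508 **v4** (unrefereed, «Preliminary version
for comments») = bib `Joshi2024ATS3`; locators «p.N l.a–b» = PDF page N, lines a–b of `HOME/lit/renders/Joshi-arxiv-2401.13508/`.
TAKES NO SIDE on [IUTchIII] Cor. 3.12, on Joshi's claims, or on Mochizuki's report on them; typed ≠ proved ≠ endorsed. No
`Prop` is introduced, nothing of Joshi's is asserted, no `Summits.ABC.IUTFork.Cor312*`/`Thm311*` module is imported (E-PLAN R14),
no FACT-LIST row is consumed; 0 `sorry`.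

WHAT THIS FILE DOES. `ThetaJoshiLocusBE.lean` (p429036) typed the adelic family `ATS3.AdelicLiftDatum` with the §5 objects of
slot T-09 — `G_E ↷ B_E`, the Frobenius `φ` of `B_E`, the `Aut(G_E)`-twists `S ↦ S^σ`, the closed convex hull, `B_E ↪ B_dR`,
`B_E ↪ B̃_E` — as BARE INTERIM FIELDS («merge-debt»), and `ThetaJoshiAdelic.lean` (p430072) derived [J-III] Thm. 6.7.1
(`thm671_of`) under two ∃-hypotheses («`G_E` acts by `O_E`-linear homeomorphisms of `B_E^{ℓ⋇}` commuting with `φ`», «`φ` is an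
`O_E`-linear homeomorphism»). Slot T-09 has since LANDED the §5 signature `PeriodRingTower` / `BEDatum` (`LocalPeriodRings.lean`,
p429989) and, in `LocalPeriodRingsProofs.lean` (p433275), CONSTRUCTED the action `galBE : G_E →* (B_E ≃ₐ[ℚ_p] B_E)` by restricting
the `G`-action on `B_dR`, proved it fixes `E` (`galBE_apply_of_mem_E`), and published the per-place merge-debt map `galAct`,
`frobRingEquiv`, `twistBE` / `subset_twistBE`, `convBE`, `val_injective_BE`, `toBtilOfSplits`. Here (imports BY NAME, nothing of
T-09 or T-10 restated):
* §A (generic, any carriers) `AdelicLiftDatum.thm671_of_continuous`: Thm. 6.7.1 (1)(2)(3) for the §6.7 basic theta-values locus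
  from POINTWISE named hypotheses — the group acts additively, `O_E`-linearly and continuously on `B_E`; `φ` is `O_E`-linear,
  continuous with continuous inverse; `g ∘ φ = φ ∘ g` — via the coordinatewise continuous linear automorphisms `smulCLE`,
  `frobCLE` of `B_E^{ℓ⋇}` fed to p430072's `thm671_of`.
* §B (one place, T-09's `BEDatum`) `galBE_smul` / `frobBE_smul`: the `O_E`-LINEARITY of `G_E ↷ B_E` and of `φ` is DISCHARGED over
  the T-09 signature as soon as the scalars map into `E ⊂ B_E` (`galBE_apply_of_mem_E`, `frobBE_of_mem`).
* §C (adelic family of T-09 carriers `B w := B_{E′_w} ⊂ Ω_w = B_dR`) `AdelicLiftDatum.ofPeriodRings`: the constructor filling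
  EVERY interim §5 field of p429036 by the T-09 constructions (`G := G_E`, `galAct`, `frob := φ_{B_E}`, `AutG := Aut(G_E)`,
  `twist := twistBE` — the literal reading (5.3.1.2) —, `conv := convBE` = §5.3.3's closed convex hull, `BdR := Ω`, `toBdR` = the
  inclusion, `Btil := B ⊗_{ℚ_p} E`, `toBtil := toBtilOfSplits e` under a witness `e` of T-09's claim (5.2.5.4) `BtildeSplits`), the
  §6.4 lift data (slot T-10's `ThetaLiftDatum` over `B_{E′_w}`) and the §6.10.2 descent data staying inputs (`LiftInput`);
  `rfl` lemmas record the identifications. This CLOSES the T-11 ↔ T-09 carrier debt in the kernel: the interim signature is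
  instantiated by, not merely analogous to, the typed §5 rings.
* §D `thm671_of_periodRings` / `thm671_ofPeriodRings`: **[J-III] Thm. 6.7.1 («Proof. … clear by construction and the
  definitions», p. 50 l. 1–3) HOLDS for the basic theta-values locus built on the T-09 rings MODULO EXACTLY**: a topology on
  `B_E` for which every `galBE g` (`g ∈ G_E`) and `φ_{B_E}`, `φ_{B_E}⁻¹` are continuous (print: the Fréchet topology, §5.3.3 p. 41
  l. 35–39 — typed by no slot), scalars `O_E → B_E` landing in `E`, and `[G_E, φ_{B_E}] = 0` on `B_E` (standard for
  `B_E = B ⊗_{E_0} E` with `φ_E = φ^{f} ⊗ 1`, [FF18]; NOT a field of `BEDatum`, whose docstring says the relation of `φ_{B_E}` to `φ_B`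
  «is NOT imposed»). These are hypotheses of theorems, located here for the referee lanes — not new `Prop` definitions, not
  GAP-LEDGER rows (they concern Joshi's §5 carriers, not OUR cone).
bears_on: LADDER-ABC:A2.E.
-/

noncomputable section

open Set

namespace Summit.ABC.IUTFork.Joshi.ATS3

/-! ## §A Theorem 6.7.1 from a continuous `O_E`-linear action commuting with `φ` (generic carriers) -/

namespace AdelicLiftDatum

variable {A : CollationDatum} {OE B : A.V → Type} [∀ w, CommRing (OE w)] [∀ w, CommRing (B w)]
  [∀ w, Algebra (OE w) (B w)] (𝔇 : AdelicLiftDatum A OE B)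
variable [∀ w, TopologicalSpace (B w)] (Γ : A.V → Type) [∀ w, Group (Γ w)] [∀ w, MulAction (Γ w) (B w)]

/-- The diagonal action of `g ∈ Γ_w` on `B_{E′_w}^{ℓ⋇}` AS an `O_{E′_w}`-linear homeomorphism ((5.3.1.2) «applied verbatim to …
`B_E^{ℓ⋇}`», p. 41 l. 5–7), granted that `Γ_w` acts on `B_{E′_w}` additively, `O_{E′_w}`-linearly and continuously (the inverse is
the action of `g⁻¹`). [folklore] -/
def smulCLE (w : A.V) (hadd : ∀ (g : Γ w) (x y : B w), g • (x + y) = g • x + g • y)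
    (hlin : ∀ (g : Γ w) (c : OE w) (x : B w), g • (c • x) = c • g • x)
    (hcont : ∀ g : Γ w, Continuous fun x : B w => g • x) (g : Γ w) :
    (Fin A.lstar → B w) ≃L[OE w] (Fin A.lstar → B w) where
  toFun m := g • m
  invFun m := g⁻¹ • m
  map_add' m m' := funext fun j => hadd g (m j) (m' j)
  map_smul' c m := funext fun j => hlin g c (m j)
  left_inv m := inv_smul_smul g m
  right_inv m := smul_inv_smul g m
  continuous_toFun := continuous_pi fun j => (hcont g).comp (continuous_apply j)
  continuous_invFun := continuous_pi fun j => (hcont g⁻¹).comp (continuous_apply j)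

/-- `smulCLE g` IS the diagonal action of `g`. [folklore] -/
theorem smulCLE_apply (w : A.V)
    (hadd : ∀ (g : Γ w) (x y : B w), g • (x + y) = g • x + g • y)
    (hlin : ∀ (g : Γ w) (c : OE w) (x : B w), g • (c • x) = c • g • x)
    (hcont : ∀ g : Γ w, Continuous fun x : B w => g • x) (g : Γ w) (m : Fin A.lstar → B w) :
    smulCLE Γ w hadd hlin hcont g m = g • m := rfl

/-- The coordinatewise Frobenius `φ` of `B_{E′_w}^{ℓ⋇}` (§5.3.2, p. 41 l. 32–33) AS an `O_{E′_w}`-linear homeomorphism, granted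
that the datum's `φ` (field `frob`) is `O_{E′_w}`-linear and continuous with continuous inverse. [folklore] -/
def frobCLE (w : A.V) (hlin : ∀ (c : OE w) (x : B w), 𝔇.frob w (c • x) = c • 𝔇.frob w x)
    (hc : Continuous (𝔇.frob w)) (hc' : Continuous (𝔇.frob w).symm) :
    (Fin A.lstar → B w) ≃L[OE w] (Fin A.lstar → B w) where
  toFun m j := 𝔇.frob w (m j)
  invFun m j := (𝔇.frob w).symm (m j)
  map_add' m m' := funext fun j => map_add (𝔇.frob w) (m j) (m' j)
  map_smul' c m := funext fun j => hlin c (m j)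
  left_inv m := funext fun j => (𝔇.frob w).symm_apply_apply (m j)
  right_inv m := funext fun j => (𝔇.frob w).apply_symm_apply (m j)
  continuous_toFun := continuous_pi fun j => hc.comp (continuous_apply j)
  continuous_invFun := continuous_pi fun j => hc'.comp (continuous_apply j)

/-- The permutation underlying `frobCLE` is file 2's `frobPerm` (the coordinatewise `φ`). [folklore] -/
theorem coe_frobCLE (w : A.V) (hlin : ∀ (c : OE w) (x : B w), 𝔇.frob w (c • x) = c • 𝔇.frob w x)
    (hc : Continuous (𝔇.frob w)) (hc' : Continuous (𝔇.frob w).symm) :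
    ((𝔇.frobCLE w hlin hc hc' : (Fin A.lstar → B w) ≃L[OE w] (Fin A.lstar → B w)) :
      (Fin A.lstar → B w) ≃ (Fin A.lstar → B w)) = 𝔇.frobPerm w :=
  Equiv.ext fun _ => rfl

/-- **[J-III] Theorem 6.7.1 (p. 49 l. 86 – p. 50 l. 3) DERIVED from pointwise named hypotheses** («Proof. The proof is clear by
construction and the definitions»): if, at every place, the group `Γ_w` (= `G_{E′_w}`) acts on `B_{E′_w}` additively, `O_{E′_w}`-linearly
and continuously, the Frobenius `φ` of `B_{E′_w}` is `O_{E′_w}`-linear and continuous with continuous inverse, and `g ∘ φ = φ ∘ g`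
(`g ∈ Γ_w`), then the basic theta-values locus `Θ̃^{B_{E′_w}}_Joshi` (§6.7: closed convex hull ∘ Frobenius stabilisation ∘
`Aut(G_E)`-enlargement of the Def. 6.6.1.1 locus) is (1) Galois stable, (2) `φ`-stable, (3) `Aut(G_{E′_w})`-stable at every
`w ∈ V^{odd,ss}`. Reduction to p430072's `thm671_of` via `smulCLE` / `frobCLE`. [claim: Joshi2024ATS3, status: disputed] -/
theorem thm671_of_continuous
    (hadd : ∀ (w : A.V) (g : Γ w) (x y : B w), g • (x + y) = g • x + g • y)
    (hlin : ∀ (w : A.V) (g : Γ w) (c : OE w) (x : B w), g • (c • x) = c • g • x)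
    (hcont : ∀ (w : A.V) (g : Γ w), Continuous fun x : B w => g • x)
    (hφlin : ∀ (w : A.V) (c : OE w) (x : B w), 𝔇.frob w (c • x) = c • 𝔇.frob w x)
    (hφc : ∀ w : A.V, Continuous (𝔇.frob w)) (hφc' : ∀ w : A.V, Continuous (𝔇.frob w).symm)
    (hcomm : ∀ (w : A.V) (g : Γ w) (x : B w), g • 𝔇.frob w x = 𝔇.frob w (g • x)) :
    𝔇.Thm671 Γ :=
  𝔇.thm671_of Γ
    (fun w _ => ⟨smulCLE Γ w (hadd w) (hlin w) (hcont w), fun _ _ => rfl,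
      fun g m => funext fun j => hcomm w g (m j)⟩)
    (fun w _ => ⟨𝔇.frobCLE w (hφlin w) (hφc w) (hφc' w), 𝔇.coe_frobCLE w (hφlin w) (hφc w) (hφc' w)⟩)

end AdelicLiftDatum

/-! ## §B One place: the `O_E`-linearity of `G_E ↷ B_E` and of `φ_{B_E}` over slot T-09's `BEDatum` -/

namespace PeriodRingTower.BEDatum

variable {F B E0 : Type} [Field F] [CommRing B] [Field E0] {Y : Type} {K : Y → Type} [∀ y, Field (K y)]
  {G : Type} [Group G] {D : PeriodRingDatum F B E0 Y K G} {p : ℕ} [Fact p.Prime] [Algebra ℚ_[p] B] {Ω : Type}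
  [Field Ω] [Algebra ℚ_[p] Ω] {T : PeriodRingTower D p Ω} (ℰ : T.BEDatum)
variable {O : Type} [CommRing O] [Algebra O (T.BE ℰ.E)]

/-- `G_E` fixes every element of `B_E` lying in `E` (T-09's `galBE_apply_of_mem_E`, element form). [folklore] -/
theorem galBE_eq_self_of_coe_mem (g : ℰ.GE) {x : T.BE ℰ.E} (hx : (x : Ω) ∈ ℰ.E) : ℰ.galBE g x = x :=
  Subtype.ext (by rw [coe_galBE]; exact g.2 _ hx)

/-- `φ_{B_E}` fixes every element of `B_E` lying in `E` (T-09's field `frobBE_of_mem`, element form). [folklore] -/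
theorem frobBE_eq_self_of_coe_mem {x : T.BE ℰ.E} (hx : (x : Ω) ∈ ℰ.E) : ℰ.frobBE x = x := by
  obtain ⟨x, hx'⟩ := x
  exact Subtype.ext (ℰ.frobBE_of_mem x hx)

/-- **`G_E ↷ B_E` is `O`-linear** for any ring of scalars `O` (use `O = O_E` or `E`) whose structure map `O → B_E` lands in `E ⊂ B_E`
— the first hypothesis of p430072's derivation of Thm. 6.7.1 (1), DISCHARGED over the T-09 signature («`G_E` acts on
`B_E = B ⊗_{E_0} E` through `B`», §5.3.1 p. 40 l. 47–49; T-09's `galBE_apply_of_mem_E`). [folklore] -/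
theorem galBE_smul (hO : ∀ c : O, ((algebraMap O (T.BE ℰ.E) c : T.BE ℰ.E) : Ω) ∈ ℰ.E) (g : ℰ.GE) (c : O)
    (x : T.BE ℰ.E) : ℰ.galBE g (c • x) = c • ℰ.galBE g x := by
  rw [Algebra.smul_def, Algebra.smul_def, map_mul, ℰ.galBE_eq_self_of_coe_mem g (hO c)]

/-- **`φ_{B_E}` is `O`-linear** for scalars landing in `E` (T-09's field `frobBE_of_mem`: «`φ` is `E`-linear: it fixes `E ⊂ B_E`»)
— the linearity half of the second hypothesis of p430072's `thm671_of`, DISCHARGED. [folklore] -/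
theorem frobBE_smul (hO : ∀ c : O, ((algebraMap O (T.BE ℰ.E) c : T.BE ℰ.E) : Ω) ∈ ℰ.E) (c : O) (x : T.BE ℰ.E) :
    ℰ.frobBE (c • x) = c • ℰ.frobBE x := by
  rw [Algebra.smul_def, Algebra.smul_def, map_mul, ℰ.frobBE_eq_self_of_coe_mem (hO c)]

end PeriodRingTower.BEDatum

/-! ## §C The adelic lift family over a family of T-09 carriers: the constructor `AdelicLiftDatum.ofPeriodRings` -/

namespace AdelicLiftDatum

/-- The INPUTS of the adelic family that are NOT §5 objects (and hence stay parameters when the §5 fields are taken from slot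
T-09): slot T-10's §6.4 lift data `ThetaLiftDatum (O_{E′_w}) (B_{E′_w}) |Y_{ℂ_p^♭,L′_w}|` at every place with the §6.5–§6.9 side
data of p429036 (`[1]`, `|1| = 1`, `|0|_K = 0`, `0 < |ξ_1|_K`), and the §6.10.2 descent data (`V_{L_mod} ≃ V ⊂ V_{L′}`, `B_{L_mod,v}`,
trace maps; p. 53 l. 19–28). Field-for-field the corresponding fields of `AdelicLiftDatum`. [claim: Joshi2024ATS3, status: disputed] -/
structure LiftInput (A : CollationDatum) (OE B : A.V → Type) [∀ w, CommRing (OE w)] [∀ w, CommRing (B w)]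
    [∀ w, Algebra (OE w) (B w)] : Type 1 where
  /-- T-10's theta-lift data over `B_{E′_w}` at every place `w` (§6.4.2–§6.4.3). -/
  lift : ∀ w : A.V, ThetaLiftDatum (OE w) (B w) (A.Y w)
  /-- `1 ∈ O_{ℂ_p^♭}` ((6.5.1), p. 48 l. 20–21). -/
  oneFlat : ∀ w : A.V, (lift w).Cflat
  /-- `[1] = 1`. -/
  teich_oneFlat : ∀ w, (lift w).teich (oneFlat w) = 1
  /-- `|1|_{ℂ_p^♭} = 1`. -/
  absFlat_oneFlat : ∀ w, (lift w).absFlat (oneFlat w) = 1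
  /-- `|0|_{K_{y′}} = 0`. -/
  absK_zero : ∀ w (y : A.Y w), (lift w).absK y 0 = 0
  /-- `0 < |ξ_{1;K_{y′}}|_{K_{y′}}`. -/
  absK_xi_pos : ∀ w (y : A.Y w), 0 < (lift w).absK y ((lift w).xi y)
  /-- `V_{L_mod}`. -/
  Vmod : Type
  /-- `V_{L_mod} ≃ V ⊂ V_{L′}`. -/
  sel : Vmod → A.V
  /-- … injective. -/
  sel_injective : Function.Injective sel
  /-- the rings `B_{L_mod,v}` (types of). -/
  Bmod : Vmod → Type
  /-- the trace maps `B_{L′_w} → B_{L_mod,v}`. -/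
  trace : ∀ v : Vmod, B (sel v) → Bmod v

section PeriodRings

variable (A : CollationDatum)
variable {F B₀ E₀ : A.V → Type} [∀ w, Field (F w)] [∀ w, CommRing (B₀ w)] [∀ w, Field (E₀ w)] {Y₀ : A.V → Type}
  {K₀ : ∀ w : A.V, Y₀ w → Type} [∀ (w : A.V) (y : Y₀ w), Field (K₀ w y)] {G₀ : A.V → Type} [∀ w, Group (G₀ w)]
  {D : ∀ w : A.V, PeriodRingDatum (F w) (B₀ w) (E₀ w) (Y₀ w) (K₀ w) (G₀ w)} {p : A.V → ℕ} [∀ w, Fact (p w).Prime]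
  [∀ w, Algebra ℚ_[p w] (B₀ w)] {Ω : A.V → Type} [∀ w, Field (Ω w)] [∀ w, Algebra ℚ_[p w] (Ω w)]
  {T : ∀ w : A.V, PeriodRingTower (D w) (p w) (Ω w)} (ℰ : ∀ w : A.V, (T w).BEDatum)
  (OE : A.V → Type) [∀ w, CommRing (OE w)] [∀ w, Algebra (OE w) ((T w).BE (ℰ w).E)]
  [∀ w, TopologicalSpace ((T w).BE (ℰ w).E)]

/-- **The adelic family of lift data REALISED on slot T-09's carriers** (merge-debt T-09 → T-11 paid from the T-11 side): at every
place `w ∈ V_{L′}` a T-09 tower `T w` (E-t3's `B`, `B_dR = Ω_w`, `t`, …) with a `p_w`-adic field datum `ℰ w` (`E = E′_w = L′_w ⊃ E_0`,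
`φ_{B_E}`), the ring `B w := B_{E′_w} = B·E′_w ⊂ Ω_w` ((5.2.4.1)); the §5 fields of p429036 are T-09's CONSTRUCTIONS — `G := G_{E′_w}` (the
stabiliser `BEDatum.GE`), `galAct := BEDatum.galAct` (restriction of `G ↷ B_dR`, p433275), `frob := φ_{B_{E′_w}}` (`frobRingEquiv`),
`AutG := Aut(G_{E′_w})` with `autId := 1`, `twist := twistBE` (the literal reading (5.3.1.2) of `S ↦ S^σ` for the diagonal action),
`conv := convBE` (§5.3.3 closed convex hull for the given topology and the scalars `O_{E′_w}`), `BdR := Ω_w` with `toBdR` the inclusion,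
`Btil := B ⊗_{ℚ_p} E′_w` with `toBtil := toBtilOfSplits (e w)` for a witness `e w` of T-09's claim (5.2.5.4) `BtildeSplits` —, while the
§6.4 lift data and the §6.10.2 descent data are the input `I`. [claim: Joshi2024ATS3, status: disputed] -/
def ofPeriodRings (I : LiftInput A OE (fun w => (T w).BE (ℰ w).E))
    (e : ∀ w : A.V, (ℰ w).Btilde ≃ₐ[ℚ_[p w]] (Fin (ℰ w).f → (T w).BE (ℰ w).E)) :
    AdelicLiftDatum A OE (fun w => (T w).BE (ℰ w).E) where
  lift := I.lift
  oneFlat := I.oneFlat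
  teich_oneFlat := I.teich_oneFlat
  absFlat_oneFlat := I.absFlat_oneFlat
  absK_zero := I.absK_zero
  absK_xi_pos := I.absK_xi_pos
  G w := (ℰ w).GE
  galAct w g := (ℰ w).galAct g
  frob w := (ℰ w).frobRingEquiv
  AutG w := MulAut (ℰ w).GE
  autId _ := 1
  twist w σ S := (ℰ w).twistBE A.lstar σ S
  subset_twist_autId w S := (ℰ w).subset_twistBE A.lstar 1 S
  conv w := (ℰ w).convBE (OE w) A.lstar
  BdR w := Ω w
  toBdR w x := (x : Ω w)
  toBdR_injective w := (ℰ w).val_injective_BE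
  Btil w := (ℰ w).Btilde
  toBtil w x := (ℰ w).toBtilOfSplits (e w) x
  Vmod := I.Vmod
  sel := I.sel
  sel_injective := I.sel_injective
  Bmod := I.Bmod
  trace := I.trace

variable (I : LiftInput A OE (fun w => (T w).BE (ℰ w).E))
  (e : ∀ w : A.V, (ℰ w).Btilde ≃ₐ[ℚ_[p w]] (Fin (ℰ w).f → (T w).BE (ℰ w).E))

/-- The lift data of the realised family are the input `I.lift` (so `liftsAt`, `thetaLocusBE`, `thetaLocusBL` of p429036 / p430072 are
computed from T-10's data over `B_{E′_w}`). [folklore] -/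
theorem ofPeriodRings_lift (w : A.V) :
    (ofPeriodRings A ℰ OE I e).lift w = I.lift w := rfl

/-- The Galois action of the realised family is T-09's `galAct` (= `galBE` as a ring automorphism). [folklore] -/
theorem ofPeriodRings_galAct (w : A.V) (g : (ℰ w).GE) :
    (ofPeriodRings A ℰ OE I e).galAct w g = (ℰ w).galAct g := rfl

/-- The Frobenius of the realised family is T-09's `φ_{B_E}`. [folklore] -/
theorem ofPeriodRings_frob (w : A.V) :
    (ofPeriodRings A ℰ OE I e).frob w = (ℰ w).frobRingEquiv := rfl

/-- The interim twist field `S ↦ S^σ` of p429036 is, on the T-09 carriers, the literal (5.3.1.2) image under the `σ`-twisted diagonal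
action (T-09's `twistImage` for `mulActionBEPi`) — and hence the `G_{E′_w}`-saturation of `S` (T-09's `twistImage_eq_saturation`).
[folklore] -/
theorem ofPeriodRings_twist (w : A.V) (σ : MulAut (ℰ w).GE)
    (S : Set (Fin A.lstar → (T w).BE (ℰ w).E)) :
    (ofPeriodRings A ℰ OE I e).twist w σ S = letI := (ℰ w).mulActionBEPi A.lstar; saturation (ℰ w).GE S := by
  letI := (ℰ w).mulActionBEPi A.lstar
  change (ℰ w).twistBE A.lstar σ S = _
  unfold PeriodRingTower.BEDatum.twistBE
  exact twistImage_eq_saturation σ S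

/-- The interim closure operator `conv` of p429036 is, on the T-09 carriers, §5.3.3's closed convex hull (T-09's `closedConvexHull`
for the scalars `O_{E′_w}` and the given topology). [folklore] -/
theorem ofPeriodRings_conv_apply (w : A.V) (S : Set (Fin A.lstar → (T w).BE (ℰ w).E)) :
    (ofPeriodRings A ℰ OE I e).conv w S = closedConvexHull (OE w) S := rfl

/-- `toBdR` of the realised family is the inclusion `B_{E′_w} ⊂ Ω_w = B_dR` ((5.2.4.1) holds BY DESIGN of T-09). [folklore] -/
theorem ofPeriodRings_toBdR (w : A.V) (x : (T w).BE (ℰ w).E) :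
    (ofPeriodRings A ℰ OE I e).toBdR w x = (x : Ω w) := rfl

/-! ## §D Theorem 6.7.1 over the T-09 carriers, modulo continuity and `[G_E, φ] = 0` -/

/-- **[J-III] Theorem 6.7.1 over the typed §5 period rings.** For ANY adelic lift family on the T-09 carriers whose Frobenius is
T-09's `φ_{B_E}` (`hfrob`), with the group `G_{E′_w}` acting through T-09's `galBE` (`hsmul`; bind `BEDatum.mulActionBE`): if the scalars
`O_{E′_w} → B_{E′_w}` land in `E′_w` (`hO`), the topology of `B_{E′_w}` makes every `galBE g` and `φ_{B_E}`, `φ_{B_E}⁻¹` continuous (`hcont`,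
`hφc`, `hφc'`), and `G_{E′_w}` commutes with `φ_{B_E}` (`hcomm`), then Thm. 6.7.1 (1)(2)(3) hold for the §6.7 basic theta-values locus. The
`O_E`-linearity inputs of p430072's `thm671_of` are discharged by §B; what remains is named above. [claim: Joshi2024ATS3, status: disputed] -/
theorem thm671_of_periodRings (𝔇 : AdelicLiftDatum A OE (fun w => (T w).BE (ℰ w).E))
    (hfrob : ∀ w, 𝔇.frob w = (ℰ w).frobRingEquiv) [∀ w, MulAction (ℰ w).GE ((T w).BE (ℰ w).E)]
    (hsmul : ∀ (w : A.V) (g : (ℰ w).GE) (x : (T w).BE (ℰ w).E), g • x = (ℰ w).galBE g x)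
    (hO : ∀ (w : A.V) (c : OE w), ((algebraMap (OE w) ((T w).BE (ℰ w).E) c : (T w).BE (ℰ w).E) : Ω w) ∈ (ℰ w).E)
    (hcont : ∀ (w : A.V) (g : (ℰ w).GE), Continuous ((ℰ w).galBE g))
    (hφc : ∀ w : A.V, Continuous (ℰ w).frobBE) (hφc' : ∀ w : A.V, Continuous (ℰ w).frobBE.symm)
    (hcomm : ∀ (w : A.V) (g : (ℰ w).GE) (x : (T w).BE (ℰ w).E),
      (ℰ w).galBE g ((ℰ w).frobBE x) = (ℰ w).frobBE ((ℰ w).galBE g x)) :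
    𝔇.Thm671 (fun w => (ℰ w).GE) := by
  refine 𝔇.thm671_of_continuous (fun w => (ℰ w).GE) ?_ ?_ ?_ ?_ ?_ ?_ ?_
  · intro w g x y
    rw [hsmul w g (x + y), hsmul w g x, hsmul w g y, map_add]
  · intro w g c x
    rw [hsmul w g (c • x), hsmul w g x, (ℰ w).galBE_smul (hO w)]
  · intro w g
    have h : (fun x : (T w).BE (ℰ w).E => g • x) = fun x => (ℰ w).galBE g x := funext (hsmul w g)
    rw [h]
    exact hcont w g
  · intro w c x
    rw [hfrob]
    exact (ℰ w).frobBE_smul (hO w) c x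
  · intro w
    rw [hfrob]
    exact hφc w
  · intro w
    rw [hfrob]
    exact hφc' w
  · intro w g x
    rw [hsmul w g (𝔇.frob w x), hsmul w g x, hfrob w]
    exact hcomm w g x

/-- **[J-III] Theorem 6.7.1 for the REALISED family `ofPeriodRings`** (its Frobenius IS `φ_{B_E}`): Galois-, `φ`- and `Aut(G_{E′_w})`-stability
of the basic theta-values locus `Θ̃^{B_{E′_w}}_Joshi` at every `w ∈ V^{odd,ss}`, modulo exactly the continuity of `galBE g`, `φ_{B_E}^{±1}` for the
chosen topology on `B_{E′_w}`, scalars in `E′_w`, and `[G_{E′_w}, φ_{B_E}] = 0`. [claim: Joshi2024ATS3, status: disputed] -/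
theorem thm671_ofPeriodRings [∀ w, MulAction (ℰ w).GE ((T w).BE (ℰ w).E)]
    (hsmul : ∀ (w : A.V) (g : (ℰ w).GE) (x : (T w).BE (ℰ w).E), g • x = (ℰ w).galBE g x)
    (hO : ∀ (w : A.V) (c : OE w), ((algebraMap (OE w) ((T w).BE (ℰ w).E) c : (T w).BE (ℰ w).E) : Ω w) ∈ (ℰ w).E)
    (hcont : ∀ (w : A.V) (g : (ℰ w).GE), Continuous ((ℰ w).galBE g))
    (hφc : ∀ w : A.V, Continuous (ℰ w).frobBE) (hφc' : ∀ w : A.V, Continuous (ℰ w).frobBE.symm)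
    (hcomm : ∀ (w : A.V) (g : (ℰ w).GE) (x : (T w).BE (ℰ w).E),
      (ℰ w).galBE g ((ℰ w).frobBE x) = (ℰ w).frobBE ((ℰ w).galBE g x)) :
    (ofPeriodRings A ℰ OE I e).Thm671 (fun w => (ℰ w).GE) :=
  thm671_of_periodRings A ℰ OE (ofPeriodRings A ℰ OE I e) (fun _ => rfl) hsmul hO hcont hφc hφc' hcomm

/-- With the CANONICAL action `BEDatum.mulActionBE` (T-09) the hypothesis `hsmul` is `rfl`: Thm. 6.7.1 for the realised family
modulo continuity, scalars in `E`, and `[G_E, φ] = 0` only. [claim: Joshi2024ATS3, status: disputed] -/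
theorem thm671_ofPeriodRings_mulActionBE
    (hO : ∀ (w : A.V) (c : OE w), ((algebraMap (OE w) ((T w).BE (ℰ w).E) c : (T w).BE (ℰ w).E) : Ω w) ∈ (ℰ w).E)
    (hcont : ∀ (w : A.V) (g : (ℰ w).GE), Continuous ((ℰ w).galBE g))
    (hφc : ∀ w : A.V, Continuous (ℰ w).frobBE) (hφc' : ∀ w : A.V, Continuous (ℰ w).frobBE.symm)
    (hcomm : ∀ (w : A.V) (g : (ℰ w).GE) (x : (T w).BE (ℰ w).E),
      (ℰ w).galBE g ((ℰ w).frobBE x) = (ℰ w).frobBE ((ℰ w).galBE g x)) :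
    letI : ∀ w, MulAction (ℰ w).GE ((T w).BE (ℰ w).E) := fun w => (ℰ w).mulActionBE
    (ofPeriodRings A ℰ OE I e).Thm671 (fun w => (ℰ w).GE) :=
  letI : ∀ w, MulAction (ℰ w).GE ((T w).BE (ℰ w).E) := fun w => (ℰ w).mulActionBE
  thm671_ofPeriodRings A ℰ OE I e (fun _ _ _ => rfl) hO hcont hφc hφc' hcomm

end PeriodRings

end AdelicLiftDatum

end Summit.ABC.IUTFork.Joshi.ATS3

end
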